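import Literature.NumberTheory.Transcendental.NesterenkoEliminationFacts2
import Literature.NumberTheory.Transcendental.NesterenkoUResultantValue
import Literature.NumberTheory.Transcendental.PhilipponCriterionRank
import HarnessLib

/-!
# LNM 1752 Ch. 3 Proposition 4.11, discharged (route B: the `u`-resultant by specialisation)

`Literature/NumberTheory/Transcendental/NesterenkoEliminationProp411Holds.lean`. The named fact
`NesterenkoPhilippon2001_ch3_prop_4_11` of `NesterenkoEliminationFacts2` (Nesterenko's metric
Bézout inequality: the homogeneous unmixed ideal `J` of the cut `V(𝔭) ∩ V(Q)` with controlled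
degree, height and values; and the Liouville-type inequality for `r = 1`) is proved here by
assembling the `u`-resultant `G = uResultant 𝔭 s d Q₀` (`s = r − 1`, `Q = q Q₀`, `Q₀` a primitive
integer form) of the series `NesterenkoUResultant*`:

* `exists_cycle_ideal_uResultant` — the unmixed homogeneous `J` of rank `r − 1` with
  `V(J) = V((𝔭, Q))` and `chowForm J (r−1) = c · G` (Prop. 4.4 and the identification of `G` with
  `∏ F_𝔮^{e_𝔮}` by specialisation at height-one primes);
* `blockDeg_uResultant` — 1) `deg J = deg 𝔭 · d`;
* `height_uResultant_le` — 2) `h(J) ≤ d h(𝔭) + deg 𝔭 · h(Q) + m (r+1) deg 𝔭 · d`;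
* part 3): from `norm_mul_maxNorm_kappa_uResultant_le` (`|q|^D |ϰ_ω̄(G)| ≤ δ · valueConst` for
  `|ω̄| = 1`) by projective invariance (`iabs_smul`, `rho_smul`, `normAt_smul`,
  `bezoutDelta_smul`), the bound `valueConst ≤ |q|^D |G| e^{h(Q) deg 𝔭 + h(𝔭) d + 11 m² deg 𝔭 · d}`
  (`valueConst_le`: `G = λ^d G₀`, `F = λ F₀`, `Q = q Q₀` with `F₀, Q₀` primitive, `G₀ ∈ ℤ[u]∖0`,
  so `|G| ≥ |λ|^d`, `|F₀| ≤ e^{h(F)}`, `|Q₀| ≤ e^{h(Q)}`, and `2 ≤ e`, `m + 1 ≤ e^m`,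
  `#supp ≤ (m+1)^{deg}`), whence `|J(ω̄)| = |ϰ_ω̄(G)|/|G| ≤ δ e^{…}` for `r ≥ 2`
  (`iabs_le_of_chowForm_eq`) and `1 ≤ δ e^{…}` for `r = 1` (`one_le_bezoutDelta_mul_exp`, with
  `G ∈ ℚ∖0` by `uResultant_ne_zero_rank_one`: a rank-`0` homogeneous prime has no projective
  zero).

The book prints no proof ("see [Nes10, Prop. 1.4]"); the route formalised is Nesterenko's
(`u`-resultant of the Chow form with `Q`), with the local analysis organised through generic
complex specialisations and valuation rings instead of the norm form over the function field.

## References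

* [NesterenkoPhilippon2001] Yu. V. Nesterenko, P. Philippon (eds.), *Introduction to Algebraic
  Independence Theory*, LNM 1752, Springer 2001, Ch. 3 §4, Prop. 4.11 (pp. 40–41).
* [Nesterenko1977] Yu. V. Nesterenko, *Estimates for the orders of zeros of functions of a certain
  class and applications in the theory of transcendental numbers*, Izv. Akad. Nauk SSSR Ser. Mat.
  41 (1977), 253–284 (§2, Lemmas 5–6, Prop. 3).
-/

noncomputable section

open MvPolynomial Filter Topology
open Literature.NumberTheory.Transcendental.PhilipponMain
open scoped Pointwise

attribute [local instance] MvPolynomial.gradedAlgebra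

namespace Literature.NumberTheory.Transcendental

namespace Nesterenko

variable {m : ℕ}

/-! ### Projective invariance in `ω̄` -/

/-- The projective distance is unchanged when the first point is rescaled. [folklore] -/
theorem projDist_smul_left {φ : Fin (m + 1) → ℂ} (ψ : Fin (m + 1) → ℂ) {c : ℂ} (hc : c ≠ 0) :
    projDist (c • φ) ψ = projDist φ ψ := by
  have hsup : (Finset.univ.sup fun q : SkewIdx m =>
      ‖(c • φ) q.1.1 * ψ q.1.2 - (c • φ) q.1.2 * ψ q.1.1‖₊) =
      ‖c‖₊ * Finset.univ.sup fun q : SkewIdx m => ‖φ q.1.1 * ψ q.1.2 - φ q.1.2 * ψ q.1.1‖₊ := by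
    rw [NNReal.mul_finset_sup]
    refine Finset.sup_congr rfl fun q _ => ?_
    rw [← nnnorm_mul]
    congr 1
    simp only [Pi.smul_apply, smul_eq_mul]
    ring
  rw [projDist, projDist, hsup, norm_smul, NNReal.coe_mul, coe_nnnorm]
  by_cases hψ : ψ = 0
  · subst hψ; simp
  by_cases hφ : φ = 0
  · subst hφ; simp
  have hc' : ‖c‖ ≠ 0 := norm_ne_zero_iff.mpr hc
  have hφ' : ‖φ‖ ≠ 0 := norm_ne_zero_iff.mpr hφ
  have hψ' : ‖ψ‖ ≠ 0 := norm_ne_zero_iff.mpr hψ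
  field_simp

/-- `ρ(c ω̄) = ρ(ω̄)`. [folklore] -/
theorem rho_smul {ω : Fin (m + 1) → ℂ} {c : ℂ} (hc : c ≠ 0) (I : Ideal (Rx m)) :
    rho (c • ω) I = rho ω I := by
  unfold rho
  rw [show projDist (c • ω) = projDist ω from funext fun β => projDist_smul_left β hc]

/-- `ϰ_{cω̄}(F) = c^N ϰ_ω̄(F)` if every monomial of `F` has degree `N`. [folklore] -/
theorem kappa_smul_of_degree {r : ℕ} (F : RU r m) {N : ℕ} (hF : ∀ γ ∈ F.support, γ.degree = N)
    (c : ℂ) (ω : Fin (m + 1) → ℂ) : kappa (c • ω) F = C (c ^ N) * kappa ω F := by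
  rw [kappa_eq_sum, kappa_eq_sum, Finset.mul_sum]
  refine Finset.sum_congr rfl fun γ hγ => ?_
  have hprod : (γ.prod fun v e => lam (c • ω) v.1 v.2 ^ e) =
      C (c ^ N) * γ.prod fun v e => lam ω v.1 v.2 ^ e := by
    rw [Finsupp.prod, Finsupp.prod]
    simp only [lam_smul, mul_pow, Finset.prod_mul_distrib]
    congr 1
    rw [Finset.prod_pow_eq_pow_sum, show ∑ v ∈ γ.support, γ v = γ.degree from rfl, hF γ hγ,
      map_pow]
  rw [hprod]; ring

/-- `|ϰ_{cω̄}(F)| = |c|^N |ϰ_ω̄(F)|`. [folklore] -/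
theorem maxNorm_kappa_smul {r : ℕ} (F : RU r m) {N : ℕ} (hF : ∀ γ ∈ F.support, γ.degree = N)
    (c : ℂ) (ω : Fin (m + 1) → ℂ) : maxNorm (kappa (c • ω) F) = ‖c‖ ^ N * maxNorm (kappa ω F) := by
  rw [kappa_smul_of_degree F hF, maxNorm_C_mul, norm_pow]

/-- **Property 2) of Definition 4.6: `|I(cω̄)| = |I(ω̄)|`** (`r ≥ 1`, `c ≠ 0`).
[cite: NesterenkoPhilippon2001, Ch. 3 Def. 4.6, property 2) (p. 39)] -/
theorem iabs_smul (I : Ideal (Rx m)) {r : ℕ} (hr : 0 < r) {c : ℂ} (hc : c ≠ 0)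
    (ω : Fin (m + 1) → ℂ) : iabs I r (c • ω) = iabs I r ω := by
  unfold iabs
  have hF : ∀ γ ∈ (chowForm I r).support, γ.degree = r * ideg I r := fun γ hγ =>
    degree_eq_of_mem_support_chowForm I hr hγ
  rw [maxNorm_kappa_smul _ hF, norm_smul, mul_pow, mul_left_comm (maxNorm _),
    mul_div_mul_left _ _ (pow_ne_zero _ (norm_ne_zero_iff.mpr hc))]

/-- `δ(cω̄) = δ(ω̄)`. [folklore] -/
theorem bezoutDelta_smul (𝔭 : Ideal (Rx m)) {r : ℕ} (hr : 0 < r) {Q : Rx m} {d : ℕ}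
    (hQ : Q.IsHomogeneous d) (hQ0 : Q ≠ 0) {c : ℂ} (hc : c ≠ 0) (ω : Fin (m + 1) → ℂ) :
    bezoutDelta 𝔭 r Q (c • ω) = bezoutDelta 𝔭 r Q ω := by
  unfold bezoutDelta
  rw [rho_smul hc, normAt_smul hQ hQ0 hc, iabs_smul 𝔭 hr hc]

/-- Normalising `ω̄ ≠ 0` to `|ω̄| = 1`. [folklore] -/
theorem norm_inv_smul_eq_one {ω : Fin (m + 1) → ℂ} (hω : ω ≠ 0) : ‖((‖ω‖⁻¹ : ℝ) : ℂ) • ω‖ = 1 := by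
  rw [norm_smul, Complex.norm_real, norm_inv, norm_norm, inv_mul_cancel₀ (norm_ne_zero_iff.mpr hω)]

/-! ### Elementary exponential bounds -/

/-- `2^k ≤ e^k`. [folklore] -/
private theorem two_pow_le_exp (k : ℕ) : (2 : ℝ) ^ k ≤ Real.exp k := by
  have h2 : (2 : ℝ) ≤ Real.exp 1 := by
    have := Real.add_one_le_exp (1 : ℝ); norm_num at this; exact this
  calc (2 : ℝ) ^ k ≤ Real.exp 1 ^ k := pow_le_pow_left₀ (by norm_num) h2 k
    _ = Real.exp k := by rw [← Real.exp_nat_mul, mul_one]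

/-- `(m+1)^k ≤ e^{m k}`. [folklore] -/
theorem succ_pow_le_exp (m k : ℕ) : ((m : ℝ) + 1) ^ k ≤ Real.exp ((m : ℝ) * k) := by
  calc ((m : ℝ) + 1) ^ k ≤ Real.exp m ^ k :=
        pow_le_pow_left₀ (by positivity) (Real.add_one_le_exp _) k
    _ = Real.exp ((m : ℝ) * k) := by rw [← Real.exp_nat_mul, mul_comm]

/-- `1 + d x ≤ e^d x` for `x ≥ 1`, `d ≥ 1` (`2 d ≤ e^d`). [folklore] -/
theorem one_add_mul_le_exp_mul {d : ℕ} (hd : 1 ≤ d) {x : ℝ} (hx : 1 ≤ x) :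
    1 + d * x ≤ Real.exp d * x := by
  have hd' : (1 : ℝ) ≤ d := by exact_mod_cast hd
  have h2d : 2 * (d : ℝ) ≤ Real.exp d := by
    have h := Real.quadratic_le_exp_of_nonneg (by positivity : (0 : ℝ) ≤ d)
    nlinarith [h, sq_nonneg ((d : ℝ) - 1)]
  nlinarith

/-- `1 ≤ |Z|` for a non-zero integer polynomial. [folklore] -/
theorem one_le_maxNorm_map {σ : Type*} {Z : MvPolynomial σ ℤ} (hZ : Z ≠ 0) :
    1 ≤ maxNorm (MvPolynomial.map (Int.castRingHom ℚ) Z) := by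
  obtain ⟨e, he⟩ := exists_coeff_ne_zero hZ
  refine le_trans ?_ (norm_coeff_le_maxNorm _ e)
  rw [coeff_map, eq_intCast, ← Rat.norm_cast_real, Rat.cast_intCast, Int.norm_cast_real,
    Int.norm_eq_abs]
  exact_mod_cast Int.one_le_abs he

/-- `|C a| = |a|`. [folklore] -/
theorem maxNorm_C' {σ K : Type*} [NormedField K] (a : K) : maxNorm (C a : MvPolynomial σ K) = ‖a‖ :=
  le_antisymm ((maxNorm_le_l1Norm _).trans_eq (l1Norm_C a))
    (by simpa using norm_coeff_le_maxNorm (C a : MvPolynomial σ K) 0)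

/-- Monotonicity of triple products of non-negative reals. [folklore] -/
private theorem mul_le_mul3 {a b c A B C : ℝ} (ha : 0 ≤ a) (hb : 0 ≤ b) (hc : 0 ≤ c) (hA : a ≤ A)
    (hB : b ≤ B) (hC : c ≤ C) : a * b * c ≤ A * B * C :=
  mul_le_mul (mul_le_mul hA hB hb (ha.trans hA)) hC hc (mul_nonneg (ha.trans hA) (hb.trans hB))

/-- `x ≤ e^y ⇒ x^n ≤ e^{n y}` for `x ≥ 0`. [folklore] -/
private theorem pow_le_exp_mul {x y : ℝ} (hx : 0 ≤ x) (h : x ≤ Real.exp y) (n : ℕ) :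
    x ^ n ≤ Real.exp (n * y) := by
  rw [Real.exp_nat_mul]; exact pow_le_pow_left₀ hx h n

/-- `x ≤ c e^y ⇒ x^n ≤ c^n e^{n y}` for `x, c ≥ 0`. [folklore] -/
private theorem pow_le_mul_exp_mul {x c y : ℝ} (hx : 0 ≤ x) (h : x ≤ c * Real.exp y) (n : ℕ) :
    x ^ n ≤ c ^ n * Real.exp (n * y) := by
  rw [Real.exp_nat_mul, ← mul_pow]; exact pow_le_pow_left₀ hx h n

/-! ### `G ≠ 0` for `s = 0` -/

/-- **A homogeneous prime of rank `0` has no projective zeros** (it would lie in the cone ideal of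
a zero, which has rank `≥ 1`). [folklore] -/
theorem not_mem_projZeros_of_rank_zero {𝔮 : Ideal (Rx m)}
    (hhom : 𝔮.IsHomogeneous (homogeneousSubmodule (Fin (m + 1)) ℚ))
    (hdim : ringKrullDim (Rx m ⧸ 𝔮) = (0 : ℕ)) (β : Fin (m + 1) → ℂ) : β ∉ projZeros 𝔮 := by
  intro hβ
  obtain ⟨k, hk⟩ := Function.ne_iff.mp hβ.1
  rw [Pi.zero_apply] at hk
  -- normalise `β_k = 1`
  set β' : Fin (m + 1) → ℂ := (β k)⁻¹ • β with hβ'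
  have hβ' : β' ∈ projZeros 𝔮 :=
    smul_mem_projZeros (fun P hP n => homogeneousComponent_mem_of_mem hhom hP n) hβ (inv_ne_zero hk)
  have hβ'k : β' k = 1 := by
    simp only [β', Pi.smul_apply, smul_eq_mul]
    exact inv_mul_cancel₀ hk
  -- `𝔮 ≤ 𝔭_{β'} < ker (P ↦ P(β'))`
  have hle : 𝔮 ≤ coneIdeal β' := fun P hP =>
    (mem_coneIdeal_iff β' P).mpr fun n => hβ'.2 _ (homogeneousComponent_mem_of_mem hhom hP n)
  set 𝔪 : Ideal (Rx m) := RingHom.ker ((aeval β' : Rx m →ₐ[ℚ] ℂ) : Rx m →+* ℂ) with h𝔪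
  have h𝔪p : 𝔪.IsPrime := RingHom.ker_isPrime _
  have hcle : coneIdeal β' ≤ 𝔪 := fun P hP => by
    rw [h𝔪, RingHom.mem_ker]
    exact (mem_projZeros_coneIdeal hβ'.1).2 P hP
  have hlt : coneIdeal β' < 𝔪 := by
    refine lt_of_le_of_ne hcle fun h => ?_
    have h1 : (X k - 1 : Rx m) ∈ 𝔪 := by
      rw [h𝔪, RingHom.mem_ker]
      simp [hβ'k]
    rw [← h, mem_coneIdeal_iff] at h1
    have h2 := h1 0
    rw [homogeneousComponent_zero] at h2
    simp at h2
  have h := ringKrullDim_quotient_add_one_le_of_lt (isPrime_coneIdeal β') hlt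
  haveI : Nontrivial (Rx m ⧸ 𝔪) := Ideal.Quotient.nontrivial_iff.mpr h𝔪p.ne_top
  have h0 : (0 : WithBot ℕ∞) ≤ ringKrullDim (Rx m ⧸ 𝔪) := ringKrullDim_nonneg_of_nontrivial
  have h1 : (1 : WithBot ℕ∞) ≤ ringKrullDim (Rx m ⧸ coneIdeal β') :=
    calc (1 : WithBot ℕ∞) = 0 + 1 := (zero_add 1).symm
      _ ≤ ringKrullDim (Rx m ⧸ 𝔪) + 1 := add_le_add h0 le_rfl
      _ ≤ _ := h
  have h2 : ringKrullDim (Rx m ⧸ coneIdeal β') ≤ ringKrullDim (Rx m ⧸ 𝔮) :=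
    ringKrullDim_le_of_surjective _ (Ideal.Quotient.factor_surjective hle)
  have h3 := h1.trans h2
  rw [hdim] at h3
  exact absurd h3 (by decide)

section Setting

variable {s : ℕ} {𝔭 : Ideal (Rx m)} {Q : Rx m} {d : ℕ} {q : ℚ}
  {Q₀ : MvPolynomial (Fin (m + 1)) ℤ}

/-- **`G ≠ 0` for `s = 0`** (`r = 1`): at a generic (empty) point `G = ĉ^d ∏ Q₀(β̂⁽ⁱ⁾)` with
`β̂⁽ⁱ⁾ ∈ V(𝔭)`, and `Q(β̂) ≠ 0` since a minimal prime of `(𝔭, Q)` has rank `0`, hence no zeros.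
[cite: NesterenkoPhilippon2001, Ch. 3 Prop. 4.11 (pp. 40–41)] -/
theorem uResultant_ne_zero_rank_one (h𝔭 : 𝔭.IsPrime)
    (hhom : 𝔭.IsHomogeneous (homogeneousSubmodule (Fin (m + 1)) ℚ))
    (hunm : IsUnmixedOfRank 𝔭 1) (hQ : Q.IsHomogeneous d) (hd : 1 ≤ d) (hQ𝔭 : Q ∉ 𝔭)
    (hQQ₀ : Q = C q * MvPolynomial.map (Int.castRingHom ℚ) Q₀)
    (hQ₀ : Q₀.IsHomogeneous d) : uResultant 𝔭 0 d Q₀ ≠ 0 := by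
  classical
  have hdim : ringKrullDim (Rx m ⧸ 𝔭) = (0 + 1 : ℕ) :=
    ringKrullDim_quotient_eq_of_isUnmixedOfRank h𝔭 hunm
  obtain ⟨z, hz⟩ := exists_injective_aeval (Fin 0 × Fin (m + 1))
  obtain ⟨cz, bz, hcz, hbz, hbz𝔭, -, -, hG⟩ := exists_split_complexSpec h𝔭 hhom hdim hQ₀ hz
  intro h0
  rw [h0, map_zero, eq_comm, mul_eq_zero, pow_eq_zero_iff (by omega : d ≠ 0),
    Finset.prod_eq_zero_iff] at hG
  rcases hG with h | ⟨i, -, hi⟩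
  · exact hcz h
  have hβQ : aeval (bz i) Q = 0 := aeval_eq_zero_of_int_model hQQ₀ hi
  set I : Ideal (Rx m) := RingHom.ker ((aeval (bz i) : Rx m →ₐ[ℚ] ℂ) : Rx m →+* ℂ) with hI
  haveI hIp : I.IsPrime := RingHom.ker_isPrime _
  have hle : 𝔭 ⊔ Ideal.span {Q} ≤ I := by
    refine sup_le (fun P hP => ?_) ?_
    · exact (RingHom.mem_ker).mpr (hbz𝔭 i P hP)
    · rw [Ideal.span_le, Set.singleton_subset_iff]
      exact (RingHom.mem_ker).mpr hβQ
  obtain ⟨𝔮, h𝔮min, h𝔮le⟩ := Ideal.exists_minimalPrimes_le hle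
  obtain ⟨-, h𝔮hom, h𝔮dim, -, -, -⟩ :=
    minimalPrimes_cut_facts (r := 1) le_rfl h𝔭 hhom hunm hQ hQ𝔭 h𝔮min
  refine not_mem_projZeros_of_rank_zero h𝔮hom h𝔮dim (bz i) ⟨hbz i, fun P hP => ?_⟩
  exact (RingHom.mem_ker).mp (h𝔮le hP)

/-! ### The constant -/

set_option maxHeartbeats 1600000 in
/-- **`valueConst ≤ |q|^D |G| exp(h(Q) deg 𝔭 + h(𝔭) d + 11 m² deg 𝔭 · d)`** for `|ω̄| = 1`
(`Q₀` primitive, `G ≠ 0`). [cite: NesterenkoPhilippon2001, Ch. 3 Prop. 4.11 3) (p. 41)] -/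
theorem valueConst_le (hsm : s + 1 ≤ m) (h𝔭 : 𝔭.IsPrime)
    (hhom : 𝔭.IsHomogeneous (homogeneousSubmodule (Fin (m + 1)) ℚ))
    (hunm : IsUnmixedOfRank 𝔭 (s + 1)) (hd : 1 ≤ d) (hq : q ≠ 0)
    (hQQ₀ : Q = C q * MvPolynomial.map (Int.castRingHom ℚ) Q₀) (hQ₀ : Q₀.IsHomogeneous d)
    (hprim : Q₀.support.gcd (fun γ => coeff γ Q₀) = 1) (hG0 : uResultant 𝔭 s d Q₀ ≠ 0)
    {ω : Fin (m + 1) → ℂ} (hω : ‖ω‖ = 1) :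
    valueConst 𝔭 s Q d ω ≤ ‖(q : ℂ)‖ ^ ideg 𝔭 (s + 1) * maxNorm (uResultant 𝔭 s d Q₀) *
      Real.exp (height Q * ideg 𝔭 (s + 1) + iheight 𝔭 (s + 1) * d +
        11 * (m : ℝ) ^ 2 * ideg 𝔭 (s + 1) * d) := by
  classical
  obtain ⟨k, rfl⟩ : ∃ k, d = k + 1 := ⟨d - 1, by omega⟩
  have hdim : ringKrullDim (Rx m ⧸ 𝔭) = (s + 1 : ℕ) :=
    ringKrullDim_quotient_eq_of_isUnmixedOfRank h𝔭 hunm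
  have hF0 : chowForm 𝔭 (s + 1) ≠ 0 := chowForm_ne_zero_of_prime h𝔭 hhom hdim
  obtain ⟨hlam, hFlam, -, hgcdF⟩ := chowFormInt_spec hF0
  obtain ⟨G₀, hG₀⟩ := exists_map_eq_normResultant h𝔭 hhom hdim hQ₀ (s := s)
  rw [normResultant] at hG₀
  set lam := chowFormScalar 𝔭 s with hlamdef
  have hlampow : lam ^ (k + 1) ≠ 0 := pow_ne_zero _ hlam
  have hGeq : uResultant 𝔭 s (k + 1) Q₀ =
      C (lam ^ (k + 1)) * MvPolynomial.map (Int.castRingHom ℚ) G₀ := by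
    rw [hG₀, ← mul_assoc, ← map_mul, ← mul_pow, mul_inv_cancel₀ hlam, one_pow, C_1, one_mul]
  have hG₀0 : G₀ ≠ 0 := by
    rintro rfl
    rw [map_zero, mul_zero] at hGeq
    exact hG0 hGeq
  -- norms of the models
  have hQ0 : MvPolynomial.map (Int.castRingHom ℚ) Q₀ ≠ 0 :=
    (map_ne_zero_iff _ (map_injective _ (RingHom.injective_int _))).mpr
      (ne_zero_of_gcd_coeff_eq_one hprim)
  set MQ := maxNorm (MvPolynomial.map (Int.castRingHom ℚ) Q₀) with hMQ
  set MF := maxNorm (MvPolynomial.map (Int.castRingHom ℚ) (chowFormInt 𝔭 s)) with hMF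
  have hF₀0 : MvPolynomial.map (Int.castRingHom ℚ) (chowFormInt 𝔭 s) ≠ 0 := by
    intro h; rw [h, mul_zero] at hFlam; exact hF0 hFlam
  have hMQpos : 0 < MQ := maxNorm_pos hQ0
  have hMFpos : 0 < MF := maxNorm_pos hF₀0
  have hMQle : MQ ≤ Real.exp (height Q) := by
    rw [hQQ₀, height_C_mul hq, ← Real.exp_log hMQpos]
    exact Real.exp_le_exp.mpr (log_maxNorm_map_le_height Q₀ hprim)
  have hMFle : MF ≤ Real.exp (iheight 𝔭 (s + 1)) := by
    rw [iheight, hFlam, height_C_mul hlam, ← Real.exp_log hMFpos]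
    exact Real.exp_le_exp.mpr (log_maxNorm_map_le_height _ hgcdF)
  have hmaxQ : maxNorm Q = ‖(q : ℂ)‖ * MQ := by
    rw [hQQ₀, maxNorm_C_mul, Complex.norm_ratCast, ← Real.norm_eq_abs, Rat.norm_cast_real]
  have hmaxF : maxNorm (chowForm 𝔭 (s + 1)) = ‖lam‖ * MF := by rw [hFlam, maxNorm_C_mul]
  have hlamn : 0 < ‖lam‖ := norm_pos_iff.mpr hlam
  have hqn : 0 < ‖(q : ℂ)‖ := norm_pos_iff.mpr (by exact_mod_cast hq)
  -- `|G| ≥ |λ|^d`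
  have hMG : ‖lam‖ ^ (k + 1) ≤ maxNorm (uResultant 𝔭 s (k + 1) Q₀) := by
    rw [hGeq, maxNorm_C_mul, norm_pow]
    exact le_mul_of_one_le_right (pow_nonneg hlamn.le _) (one_le_maxNorm_map hG₀0)
  -- supports
  have hsuppQeq : Q.support = Q₀.support := by
    rw [hQQ₀, C_mul', support_smul_eq hq, support_map_of_injective _ (RingHom.injective_int _)]
  have hnQ : (Q.support.card : ℝ) ≤ ((m : ℝ) + 1) ^ (k + 1) := by
    rw [hsuppQeq]; exact_mod_cast card_support_le_pow_of_isHomogeneous hQ₀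
  have hnQ1 : (1 : ℝ) ≤ Q.support.card := by
    rw [hsuppQeq]
    have : Q₀.support.Nonempty := by
      rw [Finset.nonempty_iff_ne_empty, Ne, support_eq_empty]
      exact ne_zero_of_gcd_coeff_eq_one hprim
    exact_mod_cast this.card_pos
  have hnF : ((chowForm 𝔭 (s + 1)).support.card : ℝ) ≤ ((m : ℝ) + 1) ^ ((s + 1) * ideg 𝔭 (s + 1)) := by
    exact_mod_cast card_support_chowForm_le_pow 𝔭 (Nat.succ_pos s)
  -- real abbreviations
  set D : ℕ := ideg 𝔭 (s + 1) with hD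
  set hQr : ℝ := height Q with hhQr
  set hFr : ℝ := iheight 𝔭 (s + 1) with hhFr
  set ν : ℕ := Fintype.card (SkewIdx m) with hν
  have hm0 : (0 : ℝ) ≤ m := Nat.cast_nonneg m
  have hm1 : (1 : ℝ) ≤ m := by exact_mod_cast (by omega : 1 ≤ m)
  have hsm' : (s : ℝ) + 1 ≤ m := by exact_mod_cast hsm
  have hD1 : (1 : ℝ) ≤ D := by
    have := one_le_ideg_of_prime_chowForm (Nat.succ_pos s)
      (prime_chowForm 𝔭 hhom (Nat.succ_pos s) hdim)
    exact_mod_cast this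
  have hνeq : 2 * (ν : ℝ) = m * (m + 1) := by
    have := two_mul_card_skewIdx m
    rw [hν]; exact_mod_cast this
  have hhQ0 : 0 ≤ hQr := height_nonneg _
  have hhF0 : 0 ≤ hFr := by rw [hhFr, iheight]; exact height_nonneg _
  -- the exponents
  set E : ℝ := (m : ℝ) * (((s + 1) * D : ℕ) : ℝ) with hE
  set a : ℝ := hFr + (m : ℝ) * D + 2 * E with ha
  set b : ℝ := (ν : ℝ) * D + 2 * E + hFr with hb
  set T : ℝ := hQr * D + hFr * ((k + 1 : ℕ) : ℝ) + 11 * (m : ℝ) ^ 2 * D * ((k + 1 : ℕ) : ℝ) with hT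
  -- the elementary bounds, all in the form `x ≤ c · e^y`
  have hA0 := archConst_nonneg 𝔭 s ω
  have hB0 := skewConst_nonneg 𝔭 s ω
  have hMQ0 : 0 ≤ maxNorm Q := maxNorm_nonneg _
  have hc0 : (0 : ℝ) ≤ Q.support.card := Nat.cast_nonneg _
  have hnF' : ((chowForm 𝔭 (s + 1)).support.card : ℝ) ≤ Real.exp E := hnF.trans (succ_pow_le_exp m _)
  have hpowF : ((m : ℝ) + 1) ^ ((s + 1) * D) ≤ Real.exp E := succ_pow_le_exp m _
  have hA : archConst 𝔭 s ω ≤ ‖lam‖ * Real.exp a := by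
    unfold archConst
    rw [hω, mul_one, hmaxF, ← hD]
    calc Real.exp ((m : ℝ) * D) * (chowForm 𝔭 (s + 1)).support.card * (‖lam‖ * MF) *
          ((m : ℝ) + 1) ^ ((s + 1) * D)
        = ‖lam‖ * Real.exp ((m : ℝ) * D) *
          ((chowForm 𝔭 (s + 1)).support.card * MF * ((m : ℝ) + 1) ^ ((s + 1) * D)) := by ring
      _ ≤ ‖lam‖ * Real.exp ((m : ℝ) * D) * (Real.exp E * Real.exp hFr * Real.exp E) :=
          mul_le_mul_of_nonneg_left (mul_le_mul3 (Nat.cast_nonneg _) hMFpos.le (by positivity)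
            hnF' hMFle hpowF) (by positivity)
      _ = ‖lam‖ * Real.exp a := by
          rw [ha, two_mul]; simp only [Real.exp_add]; ring
  have hB : skewConst 𝔭 s ω ≤ ‖lam‖ * Real.exp b := by
    unfold skewConst
    rw [hω, one_pow, mul_one, hmaxF, ← hD, ← hν]
    calc Real.exp ((ν : ℝ) * D) * ((m : ℝ) + 1) ^ ((s + 1) * D) *
          (chowForm 𝔭 (s + 1)).support.card * (‖lam‖ * MF)
        = ‖lam‖ * Real.exp ((ν : ℝ) * D) *
          (((m : ℝ) + 1) ^ ((s + 1) * D) * (chowForm 𝔭 (s + 1)).support.card * MF) := by ring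
      _ ≤ ‖lam‖ * Real.exp ((ν : ℝ) * D) * (Real.exp E * Real.exp E * Real.exp hFr) :=
          mul_le_mul_of_nonneg_left (mul_le_mul3 (by positivity) (Nat.cast_nonneg _) hMFpos.le
            hpowF hnF' hMFle) (by positivity)
      _ = ‖lam‖ * Real.exp b := by
          rw [hb, two_mul]; simp only [Real.exp_add]; ring
  have f1 : maxNorm Q ^ D ≤ ‖(q : ℂ)‖ ^ D * Real.exp (D * hQr) :=
    pow_le_mul_exp_mul hMQ0 (by rw [hmaxQ]; exact mul_le_mul_of_nonneg_left hMQle hqn.le) D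
  have f2 : (2 : ℝ) ^ ((k + 1) * D) ≤ Real.exp (((k + 1) * D : ℕ) : ℝ) := two_pow_le_exp _
  have h1Q : 1 + ((k + 1 : ℕ) : ℝ) * Q.support.card ≤
      Real.exp (((k + 1 : ℕ) : ℝ) + (m : ℝ) * ((k + 1 : ℕ) : ℝ)) := by
    rw [Real.exp_add]
    exact (one_add_mul_le_exp_mul (Nat.succ_pos k) hnQ1).trans
      (mul_le_mul_of_nonneg_left (hnQ.trans (succ_pow_le_exp m _)) (Real.exp_pos _).le)
  have h1Q0 : 0 ≤ 1 + ((k + 1 : ℕ) : ℝ) * Q.support.card :=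
    add_nonneg zero_le_one (mul_nonneg (Nat.cast_nonneg _) hc0)
  have f3 : (1 + ((k + 1 : ℕ) : ℝ) * Q.support.card) ^ D ≤
      Real.exp (D * (((k + 1 : ℕ) : ℝ) + (m : ℝ) * ((k + 1 : ℕ) : ℝ))) := pow_le_exp_mul h1Q0 h1Q D
  have f4 : archConst 𝔭 s ω ^ k ≤ ‖lam‖ ^ k * Real.exp (k * a) := pow_le_mul_exp_mul hA0 hA k
  have f4' : archConst 𝔭 s ω ^ (k + 1) ≤ ‖lam‖ ^ (k + 1) * Real.exp ((k + 1 : ℕ) * a) :=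
    pow_le_mul_exp_mul hA0 hA (k + 1)
  have g3 : (2 : ℝ) ^ (k + 1) ≤ Real.exp ((k + 1 : ℕ) : ℝ) := two_pow_le_exp _
  have g5 : (Q.support.card : ℝ) ^ (D - 1) ≤ Real.exp (D * ((m : ℝ) * ((k + 1 : ℕ) : ℝ))) :=
    (pow_le_pow_right₀ hnQ1 (Nat.sub_le D 1)).trans
      (pow_le_exp_mul hc0 (hnQ.trans (succ_pow_le_exp m _)) D)
  -- `|λ|^d ≤ |G|`
  have hgoal : ∀ {S : ℝ}, S ≤ T → ‖(q : ℂ)‖ ^ D * ‖lam‖ ^ (k + 1) * Real.exp S ≤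
      ‖(q : ℂ)‖ ^ D * maxNorm (uResultant 𝔭 s (k + 1) Q₀) * Real.exp T := fun hS =>
    mul_le_mul (mul_le_mul_of_nonneg_left hMG (pow_nonneg hqn.le _)) (Real.exp_le_exp.mpr hS)
      (Real.exp_pos _).le (mul_nonneg (pow_nonneg hqn.le _) (maxNorm_nonneg _))
  -- arithmetic of the exponents
  have hk0 : (0 : ℝ) ≤ k := Nat.cast_nonneg k
  have hD0 : (0 : ℝ) ≤ D := by linarith
  have hν' : (ν : ℝ) = m * (m + 1) / 2 := by linarith
  refine max_le ?_ ?_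
  · -- first branch
    rw [Nat.add_sub_cancel]
    set S₁ : ℝ := (D : ℝ) * hQr + (((k + 1) * D : ℕ) : ℝ) +
      (D : ℝ) * (((k + 1 : ℕ) : ℝ) + (m : ℝ) * ((k + 1 : ℕ) : ℝ)) +
      ((k : ℝ) * a + b + 5 * (m : ℝ) ^ 2 * D) with hS₁
    have hS₁T : S₁ ≤ T := by
      have hP1 : 0 ≤ (D : ℝ) * k * (9 * (m : ℝ) ^ 2 - 2 * m - 2) :=
        mul_nonneg (mul_nonneg hD0 hk0) (by nlinarith)
      have hP2 : 0 ≤ (D : ℝ) * ((m : ℝ) - 1) * (7 * m + 4) :=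
        mul_nonneg (mul_nonneg hD0 (by linarith)) (by linarith)
      have hP3 : 0 ≤ (m : ℝ) * D * ((k : ℝ) + 1) * ((m : ℝ) - s - 1) :=
        mul_nonneg (by positivity) (by linarith)
      have hdiff : 2 * (T - S₁) = 2 * ((D : ℝ) * k * (9 * (m : ℝ) ^ 2 - 2 * m - 2)) +
          (D : ℝ) * ((m : ℝ) - 1) * (7 * m + 4) +
          4 * ((m : ℝ) * D * ((k : ℝ) + 1) * ((m : ℝ) - s - 1)) := by
        rw [hT, hS₁, ha, hb, hE, hν']
        push_cast
        ring
      linarith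
    calc maxNorm Q ^ D * 2 ^ ((k + 1) * D) * (1 + ((k + 1 : ℕ) : ℝ) * Q.support.card) ^ D *
          archConst 𝔭 s ω ^ k * skewConst 𝔭 s ω * Real.exp (5 * (m : ℝ) ^ 2 * D)
        = (maxNorm Q ^ D * 2 ^ ((k + 1) * D) * (1 + ((k + 1 : ℕ) : ℝ) * Q.support.card) ^ D) *
          (archConst 𝔭 s ω ^ k * skewConst 𝔭 s ω * Real.exp (5 * (m : ℝ) ^ 2 * D)) := by ring
      _ ≤ (‖(q : ℂ)‖ ^ D * Real.exp (D * hQr) * Real.exp (((k + 1) * D : ℕ) : ℝ) *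
            Real.exp (D * (((k + 1 : ℕ) : ℝ) + (m : ℝ) * ((k + 1 : ℕ) : ℝ)))) *
          (‖lam‖ ^ k * Real.exp (k * a) * (‖lam‖ * Real.exp b) *
            Real.exp (5 * (m : ℝ) ^ 2 * D)) :=
          mul_le_mul (mul_le_mul3 (pow_nonneg hMQ0 _) (by positivity) (pow_nonneg h1Q0 _) f1 f2 f3)
            (mul_le_mul3 (pow_nonneg hA0 _) hB0 (Real.exp_pos _).le f4 hB le_rfl)
            (mul_nonneg (mul_nonneg (pow_nonneg hA0 _) hB0) (Real.exp_pos _).le)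
            (mul_nonneg (mul_nonneg (mul_nonneg (pow_nonneg hqn.le _) (Real.exp_pos _).le)
              (Real.exp_pos _).le) (Real.exp_pos _).le)
      _ = ‖(q : ℂ)‖ ^ D * ‖lam‖ ^ (k + 1) * Real.exp S₁ := by
          rw [hS₁]; simp only [Real.exp_add]; ring
      _ ≤ _ := hgoal hS₁T
  · -- second branch
    set S₂ : ℝ := (D : ℝ) * hQr + ((k + 1 : ℕ) : ℝ) * a +
      (((k + 1 : ℕ) : ℝ) + (((k + 1 : ℕ) : ℝ) + (m : ℝ) * ((k + 1 : ℕ) : ℝ))) +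
      (D : ℝ) * ((m : ℝ) * ((k + 1 : ℕ) : ℝ)) with hS₂
    have hS₂T : S₂ ≤ T := by
      have hQ1 : 0 ≤ (m : ℝ) * D * ((k : ℝ) + 1) * ((m : ℝ) - 1) :=
        mul_nonneg (by positivity) (by linarith)
      have hQ2 : 0 ≤ (m : ℝ) * D * ((k : ℝ) + 1) * ((m : ℝ) - s - 1) :=
        mul_nonneg (by positivity) (by linarith)
      have hQ3 : 0 ≤ ((k : ℝ) + 1) * ((m : ℝ) ^ 2 * D - 1) :=
        mul_nonneg (by positivity) (by nlinarith)
      have hQ4 : 0 ≤ ((k : ℝ) + 1) * m * ((m : ℝ) * D - 1) :=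
        mul_nonneg (by positivity) (by nlinarith)
      have hQ5 : 0 ≤ (m : ℝ) ^ 2 * D * ((k : ℝ) + 1) := by positivity
      have hdiff : T - S₂ = 2 * ((m : ℝ) * D * ((k : ℝ) + 1) * ((m : ℝ) - 1)) +
          2 * ((m : ℝ) * D * ((k : ℝ) + 1) * ((m : ℝ) - s - 1)) +
          2 * (((k : ℝ) + 1) * ((m : ℝ) ^ 2 * D - 1)) + ((k : ℝ) + 1) * m * ((m : ℝ) * D - 1) +
          4 * ((m : ℝ) ^ 2 * D * ((k : ℝ) + 1)) := by
        rw [hT, hS₂, ha, hE]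
        push_cast
        ring
      linarith
    calc maxNorm Q ^ D * archConst 𝔭 s ω ^ (k + 1) *
          (2 ^ (k + 1) * (1 + ((k + 1 : ℕ) : ℝ) * Q.support.card)) *
          (Q.support.card : ℝ) ^ (D - 1)
        = (maxNorm Q ^ D * archConst 𝔭 s ω ^ (k + 1) * 2 ^ (k + 1)) *
          ((1 + ((k + 1 : ℕ) : ℝ) * Q.support.card) * (Q.support.card : ℝ) ^ (D - 1)) := by ring
      _ ≤ (‖(q : ℂ)‖ ^ D * Real.exp (D * hQr) * (‖lam‖ ^ (k + 1) * Real.exp ((k + 1 : ℕ) * a)) *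
            Real.exp ((k + 1 : ℕ) : ℝ)) *
          (Real.exp (((k + 1 : ℕ) : ℝ) + (m : ℝ) * ((k + 1 : ℕ) : ℝ)) *
            Real.exp (D * ((m : ℝ) * ((k + 1 : ℕ) : ℝ)))) :=
          mul_le_mul (mul_le_mul3 (pow_nonneg hMQ0 _) (pow_nonneg hA0 _) (by positivity) f1 f4' g3)
            (mul_le_mul h1Q g5 (pow_nonneg hc0 _) (Real.exp_pos _).le)
            (mul_nonneg h1Q0 (pow_nonneg hc0 _))
            (mul_nonneg (mul_nonneg (mul_nonneg (pow_nonneg hqn.le _) (Real.exp_pos _).le)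
              (mul_nonneg (pow_nonneg hlamn.le _) (Real.exp_pos _).le)) (Real.exp_pos _).le)
      _ = ‖(q : ℂ)‖ ^ D * ‖lam‖ ^ (k + 1) * Real.exp S₂ := by
          rw [hS₂]; simp only [Real.exp_add]; ring
      _ ≤ _ := hgoal hS₂T

/-! ### The inequality of Proposition 4.11 3) -/

/-- **Part 3) for `r ≥ 2`** in the form used by the assembly: if `chowForm J s = c · G`
(`s ≥ 1`, `c ≠ 0`) then for every `ω̄ ≠ 0`,
`|J(ω̄)| ≤ δ · exp(h(Q) deg 𝔭 + h(𝔭) d + 11 m² deg 𝔭 · d)`.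
[cite: NesterenkoPhilippon2001, Ch. 3 Prop. 4.11 3) (p. 41)] -/
theorem iabs_le_of_chowForm_eq (hs : 1 ≤ s) (hsm : s + 1 ≤ m) (h𝔭 : 𝔭.IsPrime)
    (hhom : 𝔭.IsHomogeneous (homogeneousSubmodule (Fin (m + 1)) ℚ))
    (hunm : IsUnmixedOfRank 𝔭 (s + 1)) (hQ : Q.IsHomogeneous d) (hd : 1 ≤ d) (hQ𝔭 : Q ∉ 𝔭)
    (hq : q ≠ 0) (hQQ₀ : Q = C q * MvPolynomial.map (Int.castRingHom ℚ) Q₀)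
    (hQ₀ : Q₀.IsHomogeneous d) (hprim : Q₀.support.gcd (fun γ => coeff γ Q₀) = 1)
    {J : Ideal (Rx m)} {c : ℚ} (hc : c ≠ 0) (hJ : chowForm J s = C c * uResultant 𝔭 s d Q₀)
    {ω : Fin (m + 1) → ℂ} (hω : ω ≠ 0) :
    iabs J s ω ≤ bezoutDelta 𝔭 (s + 1) Q ω *
      Real.exp (height Q * ideg 𝔭 (s + 1) + iheight 𝔭 (s + 1) * d +
        11 * (m : ℝ) ^ 2 * ideg 𝔭 (s + 1) * d) := by
  classical
  have hQ0 : Q ≠ 0 := fun h => hQ𝔭 (h ▸ 𝔭.zero_mem)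
  -- normalise `|ω̄| = 1`
  set ω₁ : Fin (m + 1) → ℂ := ((‖ω‖⁻¹ : ℝ) : ℂ) • ω with hω₁
  have hcω : ((‖ω‖⁻¹ : ℝ) : ℂ) ≠ 0 := by
    exact_mod_cast inv_ne_zero (norm_ne_zero_iff.mpr hω)
  have hω₁n : ‖ω₁‖ = 1 := norm_inv_smul_eq_one hω
  rw [← iabs_smul J hs hcω ω, ← bezoutDelta_smul 𝔭 (Nat.succ_pos s) hQ hQ0 hcω ω]
  change iabs J s ω₁ ≤ bezoutDelta 𝔭 (s + 1) Q ω₁ * _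
  -- `|J(ω̄₁)| = |ϰ(G)| / |G|`
  have hG0 : uResultant 𝔭 s d Q₀ ≠ 0 := uResultant_ne_zero hs h𝔭 hhom hunm hQ hd hQ𝔭 hQQ₀ hQ₀
  have hMG : 0 < maxNorm (uResultant 𝔭 s d Q₀) := maxNorm_pos hG0
  have hcn : 0 < ‖(c : ℂ)‖ := norm_pos_iff.mpr (by exact_mod_cast hc)
  have hiabs : iabs J s ω₁ =
      maxNorm (kappa ω₁ (uResultant 𝔭 s d Q₀)) / maxNorm (uResultant 𝔭 s d Q₀) := by
    unfold iabs
    rw [hω₁n, one_pow, mul_one, hJ, kappa_C_mul', maxNorm_C_mul, maxNorm_C_mul,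
      Complex.norm_ratCast, ← Real.norm_eq_abs, Rat.norm_cast_real,
      mul_div_mul_left _ _ (norm_ne_zero_iff.mpr hc)]
  rw [hiabs, div_le_iff₀ hMG]
  have hq' : 0 < ‖(q : ℂ)‖ ^ ideg 𝔭 (s + 1) := pow_pos (norm_pos_iff.mpr (by exact_mod_cast hq)) _
  refine le_of_mul_le_mul_left ?_ hq'
  have hV := norm_mul_maxNorm_kappa_uResultant_le hsm h𝔭 hhom hunm hQ hd hQ0 hQQ₀ hQ₀ hω₁n
  have hC := valueConst_le hsm h𝔭 hhom hunm hd hq hQQ₀ hQ₀ hprim hG0 hω₁n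
  have hδ0 : 0 ≤ bezoutDelta 𝔭 (s + 1) Q ω₁ := by
    unfold bezoutDelta; split_ifs
    · exact normAt_nonneg _ _
    · exact iabs_nonneg _ _ _
  calc ‖(q : ℂ)‖ ^ ideg 𝔭 (s + 1) * maxNorm (kappa ω₁ (uResultant 𝔭 s d Q₀))
      ≤ bezoutDelta 𝔭 (s + 1) Q ω₁ * valueConst 𝔭 s Q d ω₁ := hV
    _ ≤ bezoutDelta 𝔭 (s + 1) Q ω₁ * (‖(q : ℂ)‖ ^ ideg 𝔭 (s + 1) *
          maxNorm (uResultant 𝔭 s d Q₀) * Real.exp (height Q * ideg 𝔭 (s + 1) +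
            iheight 𝔭 (s + 1) * d + 11 * (m : ℝ) ^ 2 * ideg 𝔭 (s + 1) * d)) :=
        mul_le_mul_of_nonneg_left hC hδ0
    _ = _ := by ring

/-- **Part 3) for `r = 1`** (`s = 0`): `1 ≤ δ · exp(h(Q) deg 𝔭 + h(𝔭) d + 11 m² deg 𝔭 · d)` for
every `ω̄ ≠ 0`. [cite: NesterenkoPhilippon2001, Ch. 3 Prop. 4.11 3) (p. 41)] -/
theorem one_le_bezoutDelta_mul_exp (hm : 1 ≤ m) (h𝔭 : 𝔭.IsPrime)
    (hhom : 𝔭.IsHomogeneous (homogeneousSubmodule (Fin (m + 1)) ℚ))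
    (hunm : IsUnmixedOfRank 𝔭 1) (hQ : Q.IsHomogeneous d) (hd : 1 ≤ d) (hQ𝔭 : Q ∉ 𝔭)
    (hq : q ≠ 0) (hQQ₀ : Q = C q * MvPolynomial.map (Int.castRingHom ℚ) Q₀)
    (hQ₀ : Q₀.IsHomogeneous d) (hprim : Q₀.support.gcd (fun γ => coeff γ Q₀) = 1)
    {ω : Fin (m + 1) → ℂ} (hω : ω ≠ 0) :
    (1 : ℝ) ≤ bezoutDelta 𝔭 1 Q ω *
      Real.exp (height Q * ideg 𝔭 1 + iheight 𝔭 1 * d + 11 * (m : ℝ) ^ 2 * ideg 𝔭 1 * d) := by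
  classical
  have hQ0 : Q ≠ 0 := fun h => hQ𝔭 (h ▸ 𝔭.zero_mem)
  set ω₁ : Fin (m + 1) → ℂ := ((‖ω‖⁻¹ : ℝ) : ℂ) • ω with hω₁
  have hcω : ((‖ω‖⁻¹ : ℝ) : ℂ) ≠ 0 := by
    exact_mod_cast inv_ne_zero (norm_ne_zero_iff.mpr hω)
  have hω₁n : ‖ω₁‖ = 1 := norm_inv_smul_eq_one hω
  rw [← bezoutDelta_smul 𝔭 Nat.one_pos hQ hQ0 hcω ω]
  change (1 : ℝ) ≤ bezoutDelta 𝔭 1 Q ω₁ * _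
  have hG0 : uResultant 𝔭 0 d Q₀ ≠ 0 :=
    uResultant_ne_zero_rank_one h𝔭 hhom hunm hQ hd hQ𝔭 hQQ₀ hQ₀
  have hMG : 0 < maxNorm (uResultant 𝔭 0 d Q₀) := maxNorm_pos hG0
  -- `G` is a constant: `ϰ(G) = G`
  have hκ : maxNorm (kappa ω₁ (uResultant 𝔭 0 d Q₀)) = maxNorm (uResultant 𝔭 0 d Q₀) := by
    obtain ⟨g, hg⟩ : ∃ g : ℚ, uResultant 𝔭 0 d Q₀ = C g := ⟨_, eq_C_of_isEmpty _⟩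
    rw [hg, kappa_C, maxNorm_C', maxNorm_C', Complex.norm_ratCast, ← Real.norm_eq_abs,
      Rat.norm_cast_real]
  have hq' : 0 < ‖(q : ℂ)‖ ^ ideg 𝔭 1 := pow_pos (norm_pos_iff.mpr (by exact_mod_cast hq)) _
  have hV := norm_mul_maxNorm_kappa_uResultant_le (s := 0) hm h𝔭 hhom hunm hQ hd hQ0 hQQ₀ hQ₀ hω₁n
  have hC := valueConst_le (s := 0) hm h𝔭 hhom hunm hd hq hQQ₀ hQ₀ hprim hG0 hω₁n
  rw [hκ] at hV
  have hδ0 : 0 ≤ bezoutDelta 𝔭 1 Q ω₁ := by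
    unfold bezoutDelta; split_ifs
    · exact normAt_nonneg _ _
    · exact iabs_nonneg _ _ _
  have hpos : 0 < ‖(q : ℂ)‖ ^ ideg 𝔭 1 * maxNorm (uResultant 𝔭 0 d Q₀) := mul_pos hq' hMG
  have key : ‖(q : ℂ)‖ ^ ideg 𝔭 1 * maxNorm (uResultant 𝔭 0 d Q₀) * 1 ≤
      ‖(q : ℂ)‖ ^ ideg 𝔭 1 * maxNorm (uResultant 𝔭 0 d Q₀) * (bezoutDelta 𝔭 1 Q ω₁ *
        Real.exp (height Q * ideg 𝔭 1 + iheight 𝔭 1 * d + 11 * (m : ℝ) ^ 2 * ideg 𝔭 1 * d)) := by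
    calc ‖(q : ℂ)‖ ^ ideg 𝔭 1 * maxNorm (uResultant 𝔭 0 d Q₀) * 1
        = ‖(q : ℂ)‖ ^ ideg 𝔭 1 * maxNorm (uResultant 𝔭 0 d Q₀) := mul_one _
      _ ≤ bezoutDelta 𝔭 1 Q ω₁ * valueConst 𝔭 0 Q d ω₁ := hV
      _ ≤ bezoutDelta 𝔭 1 Q ω₁ * (‖(q : ℂ)‖ ^ ideg 𝔭 1 * maxNorm (uResultant 𝔭 0 d Q₀) *
            Real.exp (height Q * ideg 𝔭 1 + iheight 𝔭 1 * d +
              11 * (m : ℝ) ^ 2 * ideg 𝔭 1 * d)) := mul_le_mul_of_nonneg_left hC hδ0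
      _ = _ := by ring
  exact le_of_mul_le_mul_left key hpos

end Setting


/-- **LNM 1752 Ch. 3 Proposition 4.11** (Nesterenko's metric Bézout inequality), discharged.
[cite: NesterenkoPhilippon2001, Ch. 3 Prop. 4.11 (pp. 40–41)] -/
theorem NesterenkoPhilippon2001_ch3_prop_4_11_holds : NesterenkoPhilippon2001_ch3_prop_4_11 := by
  intro m r 𝔭 Q d hr hrm h𝔭 hhom hunm hQ hd hQ𝔭
  classical
  -- a primitive integer model `Q = q · Q₀`
  have hQ0 : Q ≠ 0 := fun h => hQ𝔭 (h ▸ 𝔭.zero_mem)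
  obtain ⟨q, hq, Q₀, hQQ₀, hsupp, hprim⟩ := exists_eq_C_mul_map_primitive Q hQ0
  have hQ₀ : Q₀.IsHomogeneous d := by
    intro e he
    have he' : e ∈ Q.support := by rw [← hsupp]; exact mem_support_iff.mpr he
    exact hQ (mem_support_iff.mp he')
  refine ⟨fun hr2 => ?_, fun hr1 => ?_⟩
  · obtain ⟨s, rfl⟩ : ∃ s, r = s + 1 := ⟨r - 1, by omega⟩
    have hs : 1 ≤ s := by omega
    rw [Nat.add_sub_cancel]
    obtain ⟨J, c, hJhom, hJunm, hJV, hc, hJF⟩ :=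
      exists_cycle_ideal_uResultant hs hrm h𝔭 hhom hunm hQ hd hQ𝔭 hq hQQ₀ hQ₀
    obtain ⟨hdeg, hht, -⟩ := invariants_of_chowForm_eq_C_mul hs hc hJF
    refine ⟨J, hJhom, hJunm, hJV, ?_, ?_, fun ω hω => ?_⟩
    · rw [hdeg, blockDeg_uResultant hs hrm h𝔭 hhom hunm hQ hd hQ𝔭 hq hQQ₀ hQ₀]
    · rw [hht]
      refine (height_uResultant_le hs hrm h𝔭 hhom hunm hQ hd hQ𝔭 hq hQQ₀ hQ₀ hprim).trans_eq ?_
      push_cast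
      ring
    · exact iabs_le_of_chowForm_eq hs hrm h𝔭 hhom hunm hQ hd hQ𝔭 hq hQQ₀ hQ₀ hprim hc hJF hω
  · subst hr1
    intro ω hω
    exact one_le_bezoutDelta_mul_exp hrm h𝔭 hhom hunm hQ hd hQ𝔭 hq hQQ₀ hQ₀ hprim hω

end Nesterenko

end Literature.NumberTheory.Transcendental

end
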